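import Summits.HodgeConjecture.HodgeConjecture.Theorems.NikulinTwinTransportSquareHodgeOfSqrtTwoEndomorphisms
import Literature.AlgebraicGeometry.HodgeTheory.FermatJuxtapositionGysin
import Literature.AlgebraicGeometry.HodgeTheory.GysinBaseChangeOfKunneth
import Summits.HodgeConjecture.HodgeConjecture.Theorems.NikulinTwinTransportRealMultiplicationDivisorCorrespondences

/-!
# Route NikulinTwinTransport · `SquareHodgeOfSqrtTwo` (stmt-HodgeConjecture-13680) —
# the sector modulo the Künneth criterion

`squareGlue_of_kunnethCriterion` / `squareHodgeOfSqrtTwo_of_kunnethCriterion` prove the route decls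
`SquareGlue` (stmt-HodgeConjecture-13682) and `SquareHodgeOfSqrtTwo` (stmt-HodgeConjecture-13680)
BY NAME, granted:
(K) the KÜNNETH CRITERION for squares of projective K3 surfaces on the tree's carriers — if every
rational type-preserving endomorphism of `H²(S(ℂ); ℂ)` is induced by an algebraic class of
codimension `2` on `S × S` and Lefschetz `(1,1)` holds for `S`, then `HodgeConjectureFor 4 (S ⊗ S)`
(Varesco 2023 p. 8: "the Hodge conjecture for `X²` is equivalent to showing that every element of
`End_Hdg(T(X))` is algebraic"; Künneth decomposition of `H⁴((S ⊗ S)(ℂ); ℂ)` with rationality and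
Hodge types, `H² ⊗ H² ≅ End(H²)`, degrees `2` and `6` by `H¹ = 0` and `L(1,1)`, a Hodge model of
`S ⊗ S` — FORMAL DEBT, what is left of stmt-HodgeConjecture-13682);
(Ksp) Künneth SPANNING of the cross products `fst^* b ∪ snd^* w` for complex points of smooth
projective varieties (Hatcher Thm. 3.15 over the field `ℂ`; the standard hypothesis `hK` of the
tree's `gysin_baseChange_of_kunneth`, not yet a theorem of the tree);
the named facts `Huybrechts_K3_marking_exists`, `Huybrechts_K3_hodgeTypes_H2`,
`Grothendieck1969_supportedClasses_le_hodgeConiveau`; and, for `SquareHodgeOfSqrtTwo`, the two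
route items it is glued from, `RealMultiplicationSqrtTwoAlgebraic` (stmt-HodgeConjecture-13679,
open) and `LefschetzOneOneK3` (stmt-HodgeConjecture-13678).

PROVED here on the carriers (no hypothesis beyond Poincaré duality, a theorem of the tree):
* `id_induced_by_diagonal` — the identity of `H²(S(ℂ); ℂ)` is induced by the algebraic class
  `Δ_* 1` of the diagonal (`[Δ]_* = id`: projection formula and functoriality of Gysin maps);
* `fibreIntegral_of_kunnethSpan` — granted (Ksp) in the top degree of `S ⊗ S`, the fibre integral
  `fst_*(snd^* p)` of a non-zero top-degree class is a NON-ZERO multiple of `1`;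
and, from the sibling file `NikulinTwinTransportRealMultiplicationDivisorCorrespondences` (seat 3),
`divisorCorrespondence_of_fibreIntegral`: granted that fibre integral, the rank-one maps
`x ↦ (x.a) b` (`a, b ∈ NS(S)`) are induced by algebraic classes — so hypothesis (D) of
`realMultiplicationSqrtTwoAlgebraic_of_twinSimilitudeAlgebraic` now follows from (Ksp) alone.
The `End_Hdg` analysis is the sibling file `…SquareHodgeOfSqrtTwoEndomorphisms`. Sources: Varesco,
Math. Z. 305 (2023) p. 8; Hatcher, *Algebraic Topology* Thm. 3.15, 3.30; Fulton, *Intersection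
Theory* §16.1; Fulton, *Young Tableaux* App. B §B.1 (5)–(6).
Prover seat prover-pitem-stmt-HodgeConjecture-13680-0.
-/

noncomputable section

namespace Summit.HodgeConjecture.HodgeConjecture.Theorems.NikulinTwinTransport

open scoped Manifold
open Module CategoryTheory MonoidalCategory
open Literature.AlgebraicGeometry.Motives Literature.AlgebraicGeometry.HodgeTheory
open Literature.AlgebraicGeometry.Surfaces Literature.Geometry.Kaehler
open Literature.AlgebraicTopology.SingularHomology

/-! ### Algebraic correspondences on `S × S`: the diagonal, and the fibre integral -/

section Correspondences

variable {S : SchemeOver ℂ}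

/-- **The identity of `H²(S(ℂ); ℂ)` is induced by an algebraic class on `S × S`** — the class of
the diagonal, `[Δ]_* = id`: with `δ := Δ_* 1 ∈ N²H⁴((S ⊗ S)(ℂ))` (`Δ = lift 𝟙 𝟙`, Gysin images of
`1` are algebraic), `fst_*(snd^* x ∪ Δ_* 1) = fst_* Δ_*(Δ^* snd^* x ∪ 1) = (Δ ≫ fst)_* ((Δ ≫ snd)^* x) = x`
by the projection formula and functoriality. [cite: Fulton1998, §16.1 (Example 16.1.2 (c))] -/
theorem id_induced_by_diagonal (μ : OrientationFamily) (hμ : μ.HasPoincareDuality)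
    (hS : IsSmoothProjective 2 S) :
    ∃ γ ∈ algebraicClasses (S ⊗ S) 2, ∀ x : complexBetti S (2 * 1),
      x = complexGysin μ (IsSmoothProjective.tensor_holds hS hS) hS
            (SemiCartesianMonoidalCategory.fst S S)
            (rfl : 2 * 1 + 2 * 2 + 2 * 2 = 2 * 1 + 2 * (2 + 2))
            (cupProduct (rfl : 2 * 1 + 2 * 2 = 2 * 1 + 2 * 2)
              (complexBetti.map (SemiCartesianMonoidalCategory.snd S S) (2 * 1) x) γ) := by
  have hT := IsSmoothProjective.tensor_holds hS hS
  set Δ : S ⟶ S ⊗ S := CartesianMonoidalCategory.lift (𝟙 S) (𝟙 S) with hΔdef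
  refine ⟨complexGysin μ hS hT Δ (show 0 + 2 * (2 + 2) = 2 * 2 + 2 * 2 by omega)
      (singularCohomology.one ℂ (ComplexPoints S)),
    complexGysin_one_mem_algebraicClasses μ hS hT Δ (show 2 + 2 = 2 + 2 from rfl), fun x => ?_⟩
  have hproj := complexGysin_cup hμ hS hT Δ (p := 2 * 1) (q := 0) (Nat.add_zero _)
    (show 2 * 1 + 2 * (2 + 2) = 2 * 1 + 2 * 2 + 2 * 2 by omega)
    (show 0 + 2 * (2 + 2) = 2 * 2 + 2 * 2 by omega) (rfl : 2 * 1 + 2 * 2 = 2 * 1 + 2 * 2)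
    (complexBetti.map (SemiCartesianMonoidalCategory.snd S S) (2 * 1) x)
    (singularCohomology.one ℂ (ComplexPoints S))
  have hpull : complexBetti.map Δ (2 * 1) (complexBetti.map (SemiCartesianMonoidalCategory.snd S S) (2 * 1) x) = x := by
    rw [← ModuleCat.comp_apply, ← complexBetti.map_comp, hΔdef, CartesianMonoidalCategory.lift_snd,
      complexBetti.map_id, ModuleCat.id_apply]
  rw [← hproj, cupProduct_one, hpull, ← LinearMap.comp_apply,
    ← complexGysin_comp hμ hS hT hS Δ (SemiCartesianMonoidalCategory.fst S S)
      (show 2 * 1 + 2 * (2 + 2) = 2 * 1 + 2 * 2 + 2 * 2 by omega)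
      (rfl : 2 * 1 + 2 * 2 + 2 * 2 = 2 * 1 + 2 * (2 + 2))]
  have hfst : Δ ≫ SemiCartesianMonoidalCategory.fst S S = 𝟙 S := by
    rw [hΔdef, CartesianMonoidalCategory.lift_fst]
  simp only [hfst]
  rw [complexGysin_id hμ hS (2 * 1), LinearMap.id_apply]


/-- **The fibre integral of a top-degree class does not vanish, granted Künneth spanning in the
top degree.** For `S` smooth projective of dimension `n` and `0 ≠ p ∈ H²ⁿ(S(ℂ); ℂ)`,
`fst_*(snd^* p) = c₀ · 1` in `H⁰(S(ℂ); ℂ)` with `c₀ ≠ 0`, as soon as the cross products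
`fst^* b ∪ snd^* w` span `H⁴ⁿ((S ⊗ S)(ℂ); ℂ)` (Hatcher Thm. 3.15): some top-degree class of
`(S ⊗ S)(ℂ)` pairs non-trivially with `[(S ⊗ S)(ℂ)]`, hence so does some cross product
`fst^* ω ∪ snd^* w` with `ω, w` of degree `2n`, and
`⟨fst^* ω ∪ snd^* w, [S ⊗ S]⟩ = ⟨ω, fst(ℂ)_*(snd^* w ⌢ [S ⊗ S])⟩ = ⟨ω, fst_*(snd^* w) ⌢ [S]⟩`;
finally `H²ⁿ(S(ℂ))` is the line through `p` and `H⁰(S(ℂ)) = ℂ · 1`. (The two-factor case of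
the tree's `exists_complexGysin_map_ne_zero`; it feeds `divisorCorrespondence_of_fibreIntegral`.)
[cite: HatcherAT2002, §3.2 Thm. 3.15 and §3.3 Thm. 3.30] [cite: FultonYoungTableaux1997, Appendix B §B.1 (5)] -/
theorem fibreIntegral_of_kunnethSpan (μ : OrientationFamily) {n : ℕ} (hS : IsSmoothProjective n S)
    (hK : ∀ z : complexBetti (S ⊗ S) (2 * (n + n)), z ∈ Submodule.span ℂ
      {v | ∃ (i j : ℕ) (h : i + j = 2 * (n + n)) (b : complexBetti S i) (w : complexBetti S j),
        v = cupProduct h (complexBetti.map (SemiCartesianMonoidalCategory.fst S S) i b)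
          (complexBetti.map (SemiCartesianMonoidalCategory.snd S S) j w)})
    (p : complexBetti S (2 * n)) (hp : p ≠ 0) :
    ∃ c₀ : ℂ, c₀ ≠ 0 ∧
      complexGysin μ (IsSmoothProjective.tensor_holds hS hS) hS (SemiCartesianMonoidalCategory.fst S S)
          (show 2 * n + 2 * n = 0 + 2 * (n + n) by omega)
          (complexBetti.map (SemiCartesianMonoidalCategory.snd S S) (2 * n) p) =
        c₀ • singularCohomology.one ℂ (ComplexPoints S) := by
  have hμ : μ.HasPoincareDuality := OrientationFamily.hasPoincareDuality μ
  have hT := IsSmoothProjective.tensor_holds hS hS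
  letI := hT.chartedSpace
  haveI := ComplexPoints.compactSpace_of_isSmoothProjective hT
  haveI := ComplexPoints.t2Space_of_isSmoothProjective hT
  haveI := connectedSpace_complexPoints hT
  set FI : complexBetti S (2 * n) →ₗ[ℂ] complexBetti S 0 :=
    complexGysin μ hT hS (SemiCartesianMonoidalCategory.fst S S)
        (show 2 * n + 2 * n = 0 + 2 * (n + n) by omega) ∘ₗ
      (complexBetti.map (SemiCartesianMonoidalCategory.snd S S) (2 * n)).hom with hFIdef
  have hFIapply : ∀ w, FI w = complexGysin μ hT hS (SemiCartesianMonoidalCategory.fst S S)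
      (show 2 * n + 2 * n = 0 + 2 * (n + n) by omega)
      (complexBetti.map (SemiCartesianMonoidalCategory.snd S S) (2 * n) w) := fun w => rfl
  -- Step 1: some `w` has `fst_*(snd^* w) ≠ 0`
  have hex : ∃ w : complexBetti S (2 * n), FI w ≠ 0 := by
    set κ := kroneckerPairing ℂ ℂ (ComplexPoints (S ⊗ S)) (2 * (n + n)) with hκ
    have hne : (μ hT).fundamentalClass ≠ 0 := fundamentalClass_ne_zero (μ hT)
    obtain ⟨φ, hφ⟩ : ∃ φ : Module.Dual ℂ (singularHomology ℂ ℂ (ComplexPoints (S ⊗ S))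
        (2 * (n + n))), φ (μ hT).fundamentalClass ≠ 0 := by
      by_contra h
      push Not at h
      exact hne ((Module.forall_dual_apply_eq_zero_iff ℂ _).1 h)
    obtain ⟨G₀, hG₀⟩ := kroneckerPairing_surjective ℂ (ComplexPoints (S ⊗ S)) (2 * (n + n)) φ
    have hG₀ne : κ G₀ (μ hT).fundamentalClass ≠ 0 := by rw [hκ, hG₀]; exact hφ
    by_contra hall
    push Not at hall
    apply hG₀ne
    -- the pairing with `[S ⊗ S]` kills every cross product `fst^* ω ∪ snd^* w`, `ω, w` of top degree
    have key : ∀ (ω w : complexBetti S (2 * n)),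
        κ (cupProduct (show 2 * n + 2 * n = 2 * (n + n) by omega)
          (complexBetti.map (SemiCartesianMonoidalCategory.fst S S) (2 * n) ω)
          (complexBetti.map (SemiCartesianMonoidalCategory.snd S S) (2 * n) w))
          (μ hT).fundamentalClass = 0 := by
      intro ω w
      have hsign : ((-1 : ℂ) ^ (2 * n * (2 * n))) = 1 := Even.neg_one_pow ⟨n * (2 * n), by ring⟩
      rw [cupProduct_gradedComm_holds ℂ _ _ (show 2 * n + 2 * n = 2 * (n + n) by omega), hsign,
        one_smul, hκ, kroneckerPairing_cupProduct]
      change kroneckerPairing ℂ ℂ _ _ (singularCohomology.map ℂ ℂ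
        (AlgPoints.mapContinuous (L := ℂ) (SemiCartesianMonoidalCategory.fst S S)) _ ω) _ = 0
      rw [kroneckerPairing_map, ← capProduct_complexGysin hμ hT hS (SemiCartesianMonoidalCategory.fst S S)
        (show 2 * n + 2 * n = 0 + 2 * (n + n) by omega) _ (Nat.zero_add _)]
      have h0 : complexGysin μ hT hS (SemiCartesianMonoidalCategory.fst S S)
          (show 2 * n + 2 * n = 0 + 2 * (n + n) by omega)
          (complexBetti.map (SemiCartesianMonoidalCategory.snd S S) (2 * n) w) = 0 := hall w
      rw [h0, map_zero, LinearMap.zero_apply, map_zero]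
    -- hence (Künneth spanning) it kills everything
    have hle : Submodule.span ℂ {v | ∃ (i j : ℕ) (h : i + j = 2 * (n + n)) (b : complexBetti S i)
          (w : complexBetti S j),
          v = cupProduct h (complexBetti.map (SemiCartesianMonoidalCategory.fst S S) i b)
            (complexBetti.map (SemiCartesianMonoidalCategory.snd S S) j w)} ≤
        LinearMap.ker (κ.flip (μ hT).fundamentalClass) := by
      refine Submodule.span_le.2 ?_
      rintro _ ⟨i, j, h, a, v, rfl⟩
      rw [SetLike.mem_coe, LinearMap.mem_ker, LinearMap.flip_apply]
      rcases lt_trichotomy (2 * n) i with hi | hi | hi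
      · haveI := subsingleton_complexBetti hS hi
        rw [Subsingleton.elim a 0, map_zero, map_zero, LinearMap.zero_apply, map_zero,
          LinearMap.zero_apply]
      swap
      · haveI := subsingleton_complexBetti hS (show 2 * n < j by omega)
        rw [Subsingleton.elim v 0, map_zero, map_zero, map_zero, LinearMap.zero_apply]
      subst hi
      obtain rfl : j = 2 * n := by omega
      exact key a v
    have hmem := hle (hK G₀)
    rw [LinearMap.mem_ker, LinearMap.flip_apply] at hmem
    exact hmem
  -- Step 2: `H²ⁿ(S(ℂ))` is the line through `p`, and `H⁰(S(ℂ)) = ℂ · 1`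
  obtain ⟨w, hw⟩ := hex
  obtain ⟨t, rfl⟩ := exists_eq_smul_of_top μ hS hp w
  have hFIp : FI p ≠ 0 := by
    intro h0
    apply hw
    rw [map_smul, h0, smul_zero]
  obtain ⟨c₀, hc₀⟩ := exists_eq_smul_one μ hS (FI p)
  refine ⟨c₀, ?_, ?_⟩
  · rintro rfl
    apply hFIp
    rw [hc₀, zero_smul]
  · rw [← hFIapply, hc₀]

end Correspondences

/-! ### The frame: `SquareGlue` and `SquareHodgeOfSqrtTwo` modulo the Künneth criterion -/

/-- **`SquareGlue` modulo the Künneth criterion for squares of K3 surfaces.** Hypotheses: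
(K) the KÜNNETH CRITERION on the tree's carriers — for a projective K3 surface `S`, if every rational
type-preserving `ℂ`-linear endomorphism of `H²(S(ℂ); ℂ)` (every element of `End_Hdg(H²(S,ℚ))`) is
induced by an algebraic class of codimension `2` on `S × S`, and Lefschetz `(1,1)` holds for `S`,
then `HodgeConjectureFor 4 (S ⊗ S)` (Varesco: "proving the Hodge conjecture for `X²` is equivalent
to showing that every element of `End_Hdg(T(X))` is algebraic" — the Künneth decomposition of
`H⁴((S ⊗ S)(ℂ); ℂ)` with rationality and Hodge types, `H² ⊗ H² ≅ End(H²)` by Poincaré duality,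
degrees `2, 6` by `H¹ = 0` and `L(1,1)`, a Hodge model of `S ⊗ S`: FORMAL DEBT on the real
carriers, what is left of item stmt-HodgeConjecture-13682 once `End_Hdg(H²)` is known);
(Ksp) the KÜNNETH SPANNING property of the cross products for complex points of smooth projective
varieties (Hatcher Thm. 3.15; the tree's standard hypothesis of `gysin_baseChange_of_kunneth`);
and the named facts `Huybrechts_K3_marking_exists`, `Huybrechts_K3_hodgeTypes_H2`,
`Grothendieck1969_supportedClasses_le_hodgeConiveau`. Then
`RealMultiplicationSqrtTwoAlgebraic → LefschetzOneOneK3 → SquareHodgeOfSqrtTwo`: on the sector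
`End_Hdg(H²(S,ℚ)) = (NS ⊗ NS) ⊕ ℚ·id ⊕ ℚ·e` (`endHodge_normalForm_H2`), and all three summands are
algebraic — divisor correspondences by the fibre integral (`fibreIntegral_of_kunnethSpan`,
`divisorCorrespondence_of_fibreIntegral`), the identity by the diagonal (`id_induced_by_diagonal`),
and `e` by the antecedent. [cite: Varesco2023, §2 (p. 8)] [cite: HatcherAT2002, §3.2 Thm. 3.15]
[cite: Fulton1998, §16.1] -/
theorem squareGlue_of_kunnethCriterion
    (hK : ∀ (μ : OrientationFamily), μ.HasPoincareDuality → ∀ (S : SchemeOver ℂ)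
      (hS : IsSmoothProjective 2 S ∧ Subsingleton (structureSheafCohomology S.left 1) ∧
        ∃ (A : HodgeModel 2 S) (η : MForm 𝓘(ℝ, A.model) A.carrier ℂ 2),
          IsHolomorphicInCharts η ∧ ∀ x, η x ≠ 0),
      (∀ G : complexBetti S (2 * 1) →ₗ[ℂ] complexBetti S (2 * 1),
        (∀ x, IsRationalClass x → IsRationalClass (G x)) →
        (∀ (i j : ℕ) x, IsOfHodgeType 2 S (2 * 1) i j x → IsOfHodgeType 2 S (2 * 1) i j (G x)) →
        ∃ γ ∈ algebraicClasses (S ⊗ S) 2, ∀ x : complexBetti S (2 * 1),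
          G x = complexGysin μ (IsSmoothProjective.tensor_holds hS.1 hS.1) hS.1
            (SemiCartesianMonoidalCategory.fst S S)
            (rfl : 2 * 1 + 2 * 2 + 2 * 2 = 2 * 1 + 2 * (2 + 2))
            (cupProduct (rfl : 2 * 1 + 2 * 2 = 2 * 1 + 2 * 2)
              (complexBetti.map (SemiCartesianMonoidalCategory.snd S S) (2 * 1) x) γ)) →
      (∀ c : complexBetti S (2 * 1), IsRationalClass c → IsOfHodgeType 2 S (2 * 1) 1 1 c →
        c ∈ algebraicClasses S 1) →
      HodgeConjectureFor 4 (S ⊗ S))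
    (hKsp : ∀ ⦃m' n' : ℕ⦄ ⦃Y' Z' : SchemeOver ℂ⦄, IsSmoothProjective m' Y' → IsSmoothProjective n' Z' →
      ∀ (k : ℕ) (z : complexBetti (Y' ⊗ Z') k), z ∈ Submodule.span ℂ
        {v | ∃ (i j : ℕ) (h : i + j = k) (b : complexBetti Y' i) (w : complexBetti Z' j),
          v = cupProduct h (complexBetti.map (SemiCartesianMonoidalCategory.fst Y' Z') i b)
            (complexBetti.map (SemiCartesianMonoidalCategory.snd Y' Z') j w)})
    (hmark : Huybrechts_K3_marking_exists) (hHT : Huybrechts_K3_hodgeTypes_H2)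
    (hG : Grothendieck1969_supportedClasses_le_hodgeConiveau) :
    Theses.NikulinTwinTransport.SquareGlue := by
  intro hRM hL11 S hS e he_rat he_type he_adj he_N he_T hEnd
  let μ : OrientationFamily := fun _ _ h => Classical.choice (ComplexPoints.isOrientableOver ℂ h)
  have hμ : μ.HasPoincareDuality := OrientationFamily.hasPoincareDuality μ
  refine hK μ hμ S hS ?_ (hL11 S hS)
  intro G hG_rat hG_type
  obtain ⟨η, p₀, x₀, hp₀, ⟨-, -, hηint, hηcup, h20, -⟩, ⟨-, hxpos, -⟩⟩ := hmark S hS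
  have hσ0 : η.symm x₀ ≠ 0 := fun h0 =>
    ne_zero_of_star_self_re_pos hxpos (by simpa using congrArg η h0)
  obtain ⟨h1, h2, h3⟩ := hHT S hS (η.symm x₀) h20 hσ0
  rw [conjClass_marking_symm η hηint] at h2 h3
  obtain ⟨m, a, b, α, β, ha, hb, hGx⟩ := endHodge_normalForm_H2 hS η p₀ hp₀ hηint hηcup x₀ h1 h2 h3
    (fun d hd => isOfHodgeType_oneOne_of_mem_algebraicClasses hG hS hd) (hL11 S hS)
    e he_rat he_N he_T hEnd G hG_rat hG_type
  obtain ⟨c₀, hc₀, hc₀eq⟩ := fibreIntegral_of_kunnethSpan μ hS.1 (hKsp hS.1 hS.1 (2 * (2 + 2))) p₀ hp₀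
  exact induced_of_normalForm μ hS η p₀ hηcup
    (fun a' ha' b' hb' => divisorCorrespondence_of_fibreIntegral μ hμ S hS p₀ c₀ hc₀ hc₀eq ha' hb')
    (id_induced_by_diagonal μ hμ hS.1) e (hRM μ hμ S hS e he_rat he_type he_adj he_N he_T)
    a b α β ha hb G hGx

/-- **`SquareHodgeOfSqrtTwo` (item stmt-HodgeConjecture-13680) modulo the Künneth criterion (K),
Künneth spanning (Ksp), the three named facts, and the two route items it is glued from**
(`RealMultiplicationSqrtTwoAlgebraic`, stmt-HodgeConjecture-13679, an open sub-case of the Hodge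
conjecture; `LefschetzOneOneK3`, stmt-HodgeConjecture-13678): the route decl BY NAME.
[cite: Varesco2023, §2 (p. 8)] -/
theorem squareHodgeOfSqrtTwo_of_kunnethCriterion
    (hK : ∀ (μ : OrientationFamily), μ.HasPoincareDuality → ∀ (S : SchemeOver ℂ)
      (hS : IsSmoothProjective 2 S ∧ Subsingleton (structureSheafCohomology S.left 1) ∧
        ∃ (A : HodgeModel 2 S) (η : MForm 𝓘(ℝ, A.model) A.carrier ℂ 2),
          IsHolomorphicInCharts η ∧ ∀ x, η x ≠ 0),
      (∀ G : complexBetti S (2 * 1) →ₗ[ℂ] complexBetti S (2 * 1),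
        (∀ x, IsRationalClass x → IsRationalClass (G x)) →
        (∀ (i j : ℕ) x, IsOfHodgeType 2 S (2 * 1) i j x → IsOfHodgeType 2 S (2 * 1) i j (G x)) →
        ∃ γ ∈ algebraicClasses (S ⊗ S) 2, ∀ x : complexBetti S (2 * 1),
          G x = complexGysin μ (IsSmoothProjective.tensor_holds hS.1 hS.1) hS.1
            (SemiCartesianMonoidalCategory.fst S S)
            (rfl : 2 * 1 + 2 * 2 + 2 * 2 = 2 * 1 + 2 * (2 + 2))
            (cupProduct (rfl : 2 * 1 + 2 * 2 = 2 * 1 + 2 * 2)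
              (complexBetti.map (SemiCartesianMonoidalCategory.snd S S) (2 * 1) x) γ)) →
      (∀ c : complexBetti S (2 * 1), IsRationalClass c → IsOfHodgeType 2 S (2 * 1) 1 1 c →
        c ∈ algebraicClasses S 1) →
      HodgeConjectureFor 4 (S ⊗ S))
    (hKsp : ∀ ⦃m' n' : ℕ⦄ ⦃Y' Z' : SchemeOver ℂ⦄, IsSmoothProjective m' Y' → IsSmoothProjective n' Z' →
      ∀ (k : ℕ) (z : complexBetti (Y' ⊗ Z') k), z ∈ Submodule.span ℂ
        {v | ∃ (i j : ℕ) (h : i + j = k) (b : complexBetti Y' i) (w : complexBetti Z' j),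
          v = cupProduct h (complexBetti.map (SemiCartesianMonoidalCategory.fst Y' Z') i b)
            (complexBetti.map (SemiCartesianMonoidalCategory.snd Y' Z') j w)})
    (hmark : Huybrechts_K3_marking_exists) (hHT : Huybrechts_K3_hodgeTypes_H2)
    (hG : Grothendieck1969_supportedClasses_le_hodgeConiveau)
    (hRM : Theses.NikulinTwinTransport.RealMultiplicationSqrtTwoAlgebraic)
    (hL : Theses.NikulinTwinTransport.LefschetzOneOneK3) :
    Theses.NikulinTwinTransport.SquareHodgeOfSqrtTwo :=
  squareGlue_of_kunnethCriterion hK hKsp hmark hHT hG hRM hL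

end Summit.HodgeConjecture.HodgeConjecture.Theorems.NikulinTwinTransport

end
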